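import Summits.Ventures.CertifiedManyBodySolver.Theses.TcThermcert1
import Summits.Ventures.CertifiedManyBodySolver.Observables.StiffnessThermalKineticHook
import Summits.HubbardSuperconductivity.HubbardLadder.Bounds.ThermalStiffnessCeilingCurrentMoments
import HarnessLib

/-!
# NODE «linear-response / gauge-Ward» for K1′ = `TcThermcert1.ThermalStiffnessCeilingU8b8_le_7o44`
(crux-ideate seat cruxidea-stmt-Ventures-24560-3-g0; sketch only, nothing registered).

§0–§2 are a VERBATIM self-contained copy of the parent crux's `Cruxes/ThermalStiffnessCeilingU8b10_le_1o8/KuboSocket.lean`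
(§0 defs `sectorAt/dia/para/kubo`, §1 `stiffness_le_kubo`, §2 `leafAtBeta_of_kubo_frequently_add/…_eventually_add`), copied
only because the farm snapshot does not build that Cruxes module (lean check rc 75 «unbuilt» ×4); credit: hubbard-floor-idea-decomp.
§3 is this seat's: the NODE ROOT at β·t = 8 (proved) and leaf L6's first lemma (stub).
HONEST FRAMING: a model-stiffness ceiling input; nothing here is a statement about materials or a proof of superconductivity.
-/

noncomputable section

namespace Summit.Ventures.CertifiedManyBodySolver.Cruxes.ThermalStiffnessCeilingU8b8_le_7o44.LinearResponseNode

open Real Filter Topology Matrix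
open Literature.MathematicalPhysics.QuantumLattice
open Summit.Ventures.CertifiedManyBodySolver.Observables
open Summit.Ventures.CertifiedManyBodySolver.Theses

/-! ## §0 (copy of KuboSocket §0) -/

abbrev sectorAt (n : ℝ) (L : ℕ) : Finset (Orb (FermionTorus 2 L)) → Prop := fun s =>
  s.card = 2 * ⌊(1 - (1 - n)) * (L : ℝ) ^ 2 / 2⌋₊ ∧
    2 * (s.filter fun i => (ofLex i).2 = 0).card = 2 * ⌊(1 - (1 - n)) * (L : ℝ) ^ 2 / 2⌋₊

def dia (tp U n β : ℝ) (L : ℕ) [NeZero L] : ℝ :=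
  (gibbsState β ((hubbardTorusTT' L 1 tp U).toBlock (sectorAt n L) (sectorAt n L))
      ((kinOpTT' L tp).toBlock (sectorAt n L) (sectorAt n L))).re / (2 * (L : ℝ) ^ 2)

def para (tp U n β : ℝ) (L : ℕ) [NeZero L] : ℝ :=
  β / 2 * (duhamel β ((hubbardTorusTT' L 1 tp U).toBlock (sectorAt n L) (sectorAt n L))
      ((Summit.HubbardSuperconductivity.HubbardLadder.Bounds.curOpTT' L tp).toBlock (sectorAt n L) (sectorAt n L))
      ((Summit.HubbardSuperconductivity.HubbardLadder.Bounds.curOpTT' L tp).toBlock (sectorAt n L) (sectorAt n L))).re /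
    (L : ℝ) ^ 2

def kubo (tp U n β : ℝ) (L : ℕ) [NeZero L] : ℝ := dia tp U n β L - para tp U n β L

/-! ## §1 (copy of KuboSocket §1) -/

theorem stiffness_le_kubo {tp U n β ρs θ₀ : ℝ} (hβ : 0 < β) (hθ₀ : 0 < θ₀) {L : ℕ} [NeZero L] (hL : 3 ≤ L)
    (hst : ∀ θ : ℝ, |θ| ≤ θ₀ →
      β * ρs * θ ^ 2 ≤ thermalFluxLogZ L tp U (1 - n) β 0 - thermalFluxLogZ L tp U (1 - n) β θ) :
    ρs ≤ kubo tp U n β L := by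
  have hL0 : (0 : ℝ) < (L : ℝ) := by exact_mod_cast (show 0 < L by omega)
  have hL2 : (0 : ℝ) < (L : ℝ) ^ 2 := by positivity
  obtain ⟨h1, -⟩ :=
    Summit.HubbardSuperconductivity.HubbardLadder.Bounds.thermalStiffnessTT'_le_kin_sub_duhamel hL tp U hβ hθ₀
      (sectorAt n L) (by
        intro θ hθ
        have h := hst θ hθ
        simpa only [thermalFluxLogZ] using h)
  have key : ρs ≤
      ((gibbsState β ((hubbardTorusTT' L 1 tp U).toBlock (sectorAt n L) (sectorAt n L))
            ((kinOpTT' L tp).toBlock (sectorAt n L) (sectorAt n L))).re / 2 -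
          β / 2 * (duhamel β ((hubbardTorusTT' L 1 tp U).toBlock (sectorAt n L) (sectorAt n L))
            ((Summit.HubbardSuperconductivity.HubbardLadder.Bounds.curOpTT' L tp).toBlock (sectorAt n L) (sectorAt n L))
            ((Summit.HubbardSuperconductivity.HubbardLadder.Bounds.curOpTT' L tp).toBlock (sectorAt n L) (sectorAt n L))).re) /
        (L : ℝ) ^ 2 := by
    rw [le_div_iff₀ hL2]
    exact h1
  have e : kubo tp U n β L =
      ((gibbsState β ((hubbardTorusTT' L 1 tp U).toBlock (sectorAt n L) (sectorAt n L))
            ((kinOpTT' L tp).toBlock (sectorAt n L) (sectorAt n L))).re / 2 -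
          β / 2 * (duhamel β ((hubbardTorusTT' L 1 tp U).toBlock (sectorAt n L) (sectorAt n L))
            ((Summit.HubbardSuperconductivity.HubbardLadder.Bounds.curOpTT' L tp).toBlock (sectorAt n L) (sectorAt n L))
            ((Summit.HubbardSuperconductivity.HubbardLadder.Bounds.curOpTT' L tp).toBlock (sectorAt n L) (sectorAt n L))).re) /
        (L : ℝ) ^ 2 := by
    unfold kubo dia para
    field_simp
  rw [e]
  exact key

/-! ## §2 (copy of KuboSocket §2) -/

theorem leafAtBeta_of_kubo_frequently_add {tp U n β : ℝ} (hβ : 0 < β) {c : ℚ}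
    (hk : ∀ Ls : ℕ → ℕ, Tendsto Ls atTop atTop → ∀ ε : ℝ, 0 < ε →
      ∃ᶠ j : ℕ in atTop, ∀ [NeZero (Ls j)], kubo tp U n β (Ls j) ≤ ((c : ℚ) : ℝ) + ε) :
    ObsThermalStiffnessSeqCeilingAtBeta tp U n β c := by
  intro ρs θ₀ _hρs hθ₀ Ls hLs hst
  refine le_of_forall_pos_le_add fun ε hε => ?_
  obtain ⟨j, hjk, hj3⟩ := ((hk Ls hLs ε hε).and_eventually (hLs.eventually_ge_atTop 3)).exists
  haveI : NeZero (Ls j) := ⟨by omega⟩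
  have hkj : kubo tp U n β (Ls j) ≤ ((c : ℚ) : ℝ) + ε := hjk
  exact (stiffness_le_kubo hβ hθ₀ hj3 (fun θ hθ => hst j θ hθ)).trans hkj

theorem leafAtBeta_of_kubo_eventually_add {tp U n β : ℝ} (hβ : 0 < β) {c : ℚ}
    (hk : ∀ ε : ℝ, 0 < ε → ∀ᶠ L : ℕ in atTop, ∀ [NeZero L], kubo tp U n β L ≤ ((c : ℚ) : ℝ) + ε) :
    ObsThermalStiffnessSeqCeilingAtBeta tp U n β c :=
  leafAtBeta_of_kubo_frequently_add hβ fun _Ls hLs ε hε => (hLs.eventually (hk ε hε)).frequently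

/-! ## §3 This seat: NODE ROOT at β·t = 8 and leaf L6's first lemma -/

/-- **NODE ROOT (proved).** K1′ from an eventual Kubo-curvature ceiling at the anchor `(t′,U,n,β) = (0,8,7/8,8)`
with the crux constant `7/44`. -/
theorem k1prime_of_kubo_eventually_add
    (hk : ∀ ε : ℝ, 0 < ε → ∀ᶠ L : ℕ in atTop, ∀ [NeZero L], kubo 0 8 (7 / 8) 8 L ≤ ((7 / 44 : ℚ) : ℝ) + ε) :
    TcThermcert1.ThermalStiffnessCeilingU8b8_le_7o44 :=
  leafAtBeta_of_kubo_eventually_add (by norm_num) hk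

/-- **LEAF L6 — first lemma (stub, M-sized, finite-dimensional).** The `U → ∞` kinematic rung at fixed side `L ≥ 3`, any
`β > 0`: the doublon-free limit of the sector Gibbs state puts `DIA_L` below the sector hole density `δ_L ≤ 1/8 + 2/L²`
(projected x-hopping `P₀ K_x P₀` has operator norm `≤ 2·(L² − N_L)`: at most two x-moves per hole, all entries `±1`;
Gershgorin; degenerate perturbation theory for the `U → ∞` limit of the Gibbs state onto the `D = 0` block). With
`kubo ≤ dia` this is the exact sense in which the K1 constant `1/8` is «the U = ∞ kinematic value» (CENSUS-idea-decomp-r2 §1),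
typed. It closes NOTHING toward K1′ at `U = 8` (the interpolation in `U` is J-driven pairing = summit content). -/
theorem stub_dia_limsup_U_atTop_le (β : ℝ) (hβ : 0 < β) (L : ℕ) [NeZero L] (hL : 3 ≤ L) :
    limsup (fun U : ℝ => dia 0 U (7 / 8) β L) atTop ≤ 1 / 8 + 2 / (L : ℝ) ^ 2 := by
  sorry

end Summit.Ventures.CertifiedManyBodySolver.Cruxes.ThermalStiffnessCeilingU8b8_le_7o44.LinearResponseNode

end
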